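import Summits.HodgeConjecture.HodgeConjecture.Theorems.Ring2WeilCoverageNormTable
import Summits.HodgeConjecture.HodgeConjecture.Theorems.Ring2WeilCoverageProductWindowN
import HarnessLib

/-!
# Ring 2 · Weil-type family-coverage census (ring2-b06, gen 101) — norm classes of the W6.1.19 product family

research route conditional on HC_CM; not a corollary; Q11.4-sentence-2 already refuted in dim ≥ 3.
`HC_CM` (`Theses.RankFourFaces.CMAbelianHodge`, by name) does not occur in this file; no case of the Hodge
conjecture is claimed. Cell `pub-hodge-ring2`, seat `ring2-b06` (gen 101), census file `WEIL-FAMILY-COVERAGE.md`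
block «### b06.23» (B′): the Lie route of the seat's permutation-window engine (`bigsym.py`) splits the hidden
factor `B_t` of ring2-b04's one-parameter curve family `C₄ × S₁₉ (18.1, 4⁴.2.1, 2⁹.1; 2.1¹⁷)` on the sixfold row
W6.1.19 = `(3, ℚ(i), δ = [-19])` into a `(2,2)` `ℚ(i)`-fourfold piece of norm class `[161] = [7·23]` and a
`(1,1)` `ℚ(i)`-surface piece of norm class `[-3059]`, `3059 = 7·19·23`. This file pins the ARITHMETIC of that
splitting in the kernel — nothing about the family itself (a topological computation recorded in the census):

* `SqrtNeg1.not_mem_3059` — `3059 ∉ Nm(ℚ(i)ˣ)` (descent at the inert prime `7`);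
* `fourfold_sqrtNeg1_161_ne_split` — the fourfold component `(2, ℚ(i), δ = [161])` is NOT the split one
  (uses ring2-b04's `SqrtNeg1.not_mem_161`, file `Ring2WeilCoverageProductWindowN`, by name);
* `surface_sqrtNeg1_neg3059_ne_split` — the class `[-3059]` is not the split class at `n = 1`;
* `sixfold_neg19_eq_fourfold_mul_surface_sqrtNeg1` — the class identity `[-19] = [161] · [-3059]` in
  `ℚˣ/Nm(ℚ(i)ˣ)` (the discriminant class of an orthogonal sum is the product of the classes: the sixfold row key
  W6.1.19 is recovered from the two pieces).

Sorry-free; axioms standard; no `def`, no named fact; `decide` only on residues modulo `7` and parities.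

## References

* [vanGeemen1994HodgeAV] B. van Geemen, LNM 1594 (1994), 4.14, 5.4 and (5.4.1).
* [Serre1973] J.-P. Serre, A Course in Arithmetic (1973), Ch. III §1.
-/

noncomputable section

set_option linter.dupNamespace false

open Literature.AlgebraicGeometry.Motives
open Literature.AlgebraicGeometry.VanGeemen1994
open Summit.HodgeConjecture.HodgeConjecture.Ring2.Hypotheses

namespace Summit.HodgeConjecture.HodgeConjecture.Ring2.WeilCoverage

namespace SqrtNeg1

/-- `3059 = 7·19·23 ∉ Nm(ℚ(√-1)ˣ)`: descent at the inert prime `7` (`-1` is a non-square mod `7`, `7 ∥ 3059`); `T(3059) = {2, 7, 19, 23}`. research route conditional on HC_CM; not a corollary; Q11.4-sentence-2 already refuted in dim ≥ 3. [cite: Serre1973, Ch. III §1] -/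
theorem not_mem_3059 : Units.mk0 (3059 : ℚ) (by norm_num) ∉ normUnitsSubgroup ℚ (weilField 1) := by
  simpa using natCast_not_mem_normUnitsSubgroup_of_inert (d := 1) (a := 3059) (p := 7)
    (by norm_num) (by decide) (by norm_num) (by norm_num) (by norm_num)

end SqrtNeg1

/-- The FOURFOLD row W4.1.161 = `(2, ℚ(√-1), δ = [161])` (`T = {7, 23}`) is NON-split: `[(161 : ℚ)] ≠ splitDiscriminantClass 2 1` — no hyperbolic / `X × X̂`-type / uniformly weighted `E_K² × E_K²` member on that component. In the census this is the class of the moving `(2,2)`-piece of ring2-b04's W6.1.19 family (block «### b06.23» (B′)). research route conditional on HC_CM; not a corollary; Q11.4-sentence-2 already refuted in dim ≥ 3. [cite: vanGeemen1994HodgeAV, (5.4.1)] -/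
theorem fourfold_sqrtNeg1_161_ne_split :
    (QuotientGroup.mk (Units.mk0 (161 : ℚ) (by norm_num)) : weilNormResidueGroup 1) ≠ splitDiscriminantClass 2 1 :=
  mk_ne_split_of_even (by decide) _ SqrtNeg1.not_mem_161

/-- The class `[(-3059 : ℚ)]` is not the split class at `n = 1` (`K = ℚ(√-1)`): `[-3059] ≠ splitDiscriminantClass 1 1`. In the census this is the class of the `(1,1)`-piece of ring2-b04's W6.1.19 family (block «### b06.23» (B′)). research route conditional on HC_CM; not a corollary; Q11.4-sentence-2 already refuted in dim ≥ 3. [cite: vanGeemen1994HodgeAV, (5.4.1)] -/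
theorem surface_sqrtNeg1_neg3059_ne_split :
    (QuotientGroup.mk (Units.mk0 (-3059 : ℚ) (by norm_num)) : weilNormResidueGroup 1) ≠ splitDiscriminantClass 1 1 :=
  mk_neg_ne_split_of_odd (by decide) _ SqrtNeg1.not_mem_3059

/-- The discriminant class of an orthogonal sum is the product of the classes: in `ℚˣ/Nm(ℚ(√-1)ˣ)` one has `[-19] = [161] · [-3059]` (indeed `161 · (-3059) = -19 · 161²` and `161² = Nm(161)`), so the sixfold row key W6.1.19 (`δ = [-19]`) is recovered from the fourfold piece (`[161]`) and the surface piece (`[-3059]`) of block «### b06.23» (B′). research route conditional on HC_CM; not a corollary; Q11.4-sentence-2 already refuted in dim ≥ 3. [cite: vanGeemen1994HodgeAV, (5.4.1)] -/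
theorem sixfold_neg19_eq_fourfold_mul_surface_sqrtNeg1 :
    (QuotientGroup.mk (Units.mk0 (-19 : ℚ) (by norm_num)) : weilNormResidueGroup 1)
      = (QuotientGroup.mk (Units.mk0 (161 : ℚ) (by norm_num)) : weilNormResidueGroup 1)
        * (QuotientGroup.mk (Units.mk0 (-3059 : ℚ) (by norm_num)) : weilNormResidueGroup 1) := by
  rw [← QuotientGroup.mk_mul, QuotientGroup.eq, mk0_mul_mk0]
  have h : Units.mk0 ((25921 : ℚ)) (by norm_num) ∈ normUnitsSubgroup ℚ (weilField 1) :=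
    mem_normUnitsSubgroup_of_sq_add_mul_sq (d := 1) (a := (25921 : ℚ)) (by norm_num) (161 : ℚ) (0 : ℚ) (by norm_num)
  have e : (Units.mk0 (-19 : ℚ) (by norm_num))⁻¹ * Units.mk0 ((161 : ℚ) * (-3059 : ℚ)) (by norm_num)
      = Units.mk0 ((25921 : ℚ)) (by norm_num) := by
    ext; push_cast; norm_num
  rw [e]
  exact h

end Summit.HodgeConjecture.HodgeConjecture.Ring2.WeilCoverage
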